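import Mathlib
import Summits.Parity.BatemanHorn.Theorems.AlmostPrimeZerosSystemMomentDeficitCrtPairCount
import Summits.Parity.BatemanHorn.Theorems.AlmostPrimeZerosSystemMertens
import Literature.NumberTheory.Sieve.PolynomialCongruencesMeanValues
import Literature.NumberTheory.Sieve.ParityWave0SchinzelBatemanHornProofs
import HarnessLib

/-!
# Crux `SystemMomentDeficit` (stmt-Parity-11326): the near-pair covariance bound, upper side

Companion of `AlmostPrimeZerosSystemMomentDeficitNearPairCov.lean` (line `Ideator3Sketch`,
`stub_nearPairCov`: for coprime prime powers `q₁, q₂` the product of the marginal frequencies of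
`q₁ ∣ g₁(n)⁺`, `q₂ ∣ g₂(n)⁺` over `0 ≤ n ≤ x` exceeds the joint frequency by at most `C/(x+1)`).
Here the REVERSE inequality is proved: the joint frequency exceeds the product of the marginals by
at most `C/(x+1)` as well, so that the pair covariances of the small-prime indicators are
two-sidedly `O(1/(x+1))` below the hyperbola.  This is the input of the two-sided localisation of
the moment deficit (`AlmostPrimeZerosSystemMomentDeficitLocalisation*.lean`).

Notation.  `Y = x + 1`, `m_i(n) = (g_i(n))⁺ = (g_i.eval n).toNat`, `ρ_i = polyRootCountMod ![g_i] q_i`,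
`E_i = #{n < Y : q_i ∣ m_i(n) ≠ 0}`, `E₁₂ = #{n < Y : q₁ ∣ m₁(n) ≠ 0 ∧ q₂ ∣ m₂(n) ≠ 0}`.

Proof.  Joint UPPER count `E₁₂ ≤ #{n < Y : q₁ ∣ g₁(n), q₂ ∣ g₂(n)} ≤ ρ₁ρ₂(⌊Y/(q₁q₂)⌋ + 1)` (CRT
pair count `stub_crtPairCount`); marginal LOWER counts `E_i ≥ ρ_i⌊Y/q_i⌋ − n₀`
(`SystemMertens.le_card_filter_range_dvd_eval`, `SystemMertens.card_filter_dvd_eval_le_add`: the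
`ℤ`-divisibility set exceeds the `toNat` set by at most the `n₀` arguments where some `g_i(n) ≤ 0`,
`eventually_eval_natCast_pos`); marginal upper count
`E₂ ≤ ρ₂(⌊Y/q₂⌋ + 1)`; then the real algebra
`Y·E₁₂ − E₁E₂ ≤ Y(ρ₁ρ₂ + ρ₁(ρ₂ + n₀) + 2(ρ₁ + n₀)ρ₂)` and Hooley's uniform bound
`ρ_i(p^a) ≤ dᵢMᵢ` (`exists_rootCount_primePow_le`).  Everything is [folklore]; no definitions are
introduced.
-/

namespace Summit.Parity.BatemanHorn.Cruxes.SystemMomentDeficit.Localisation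

open Finset Polynomial Filter
open Literature.NumberTheory.Sieve
open Summit.Parity.BatemanHorn.Theorems.AlmostPrimeZeros.SystemMertens
open Summit.Parity.BatemanHorn.Cruxes.SystemMomentDeficit.Ideator3Sketch

/-- The `toNat` divisibility set is contained in the `ℤ`-divisibility set:
`#{n < N : q₁ ∣ g₁(n)⁺ ≠ 0 ∧ q₂ ∣ g₂(n)⁺ ≠ 0} ≤ #{n < N : q₁ ∣ g₁(n) ∧ q₂ ∣ g₂(n)}`. [folklore] -/
theorem card_filter_dvd_toNat_and_le_int (g₁ g₂ : ℤ[X]) (q₁ q₂ N : ℕ) :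
    #((range N).filter fun n : ℕ =>
        (q₁ ∣ (g₁.eval (n : ℤ)).toNat ∧ (g₁.eval (n : ℤ)).toNat ≠ 0) ∧
          (q₂ ∣ (g₂.eval (n : ℤ)).toNat ∧ (g₂.eval (n : ℤ)).toNat ≠ 0)) ≤
      #((range N).filter fun n : ℕ => (q₁ : ℤ) ∣ g₁.eval (n : ℤ) ∧ (q₂ : ℤ) ∣ g₂.eval (n : ℤ)) :=
  card_le_card fun n hn => by
    rw [mem_filter] at hn ⊢
    exact ⟨hn.1, (dvd_toNat_and_ne_zero_iff.1 hn.2.1).2, (dvd_toNat_and_ne_zero_iff.1 hn.2.2).2⟩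

/-- The real-algebra step of the upper side: if `e₁₂ ≤ ρ₁ρ₂(Y/(q₁q₂) + 1)`,
`e₁ ≥ ρ₁(Y/q₁ − 1) − n₀`, `0 ≤ e₂`, `ρ₂(Y/q₂ − 1) − n₀ ≤ e₂ ≤ ρ₂(Y/q₂ + 1)` with `Y, q₁, q₂ ≥ 1`,
`0 ≤ ρᵢ ≤ Rᵢ`, `0 ≤ n₀`, then `e₁₂/Y − (e₁/Y)(e₂/Y) ≤ (R₁R₂ + R₁(R₂ + n₀) + 2(R₁ + n₀)R₂)/Y`. [folklore] -/
theorem nearPairCovUpper_algebra {e₁ e₂ e₁₂ ρ₁ ρ₂ R₁ R₂ n₀ Y q₁ q₂ : ℝ} (hY : 1 ≤ Y) (hq₁ : 1 ≤ q₁)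
    (hq₂ : 1 ≤ q₂) (hρ₁ : 0 ≤ ρ₁) (hρ₂ : 0 ≤ ρ₂) (hR₁ : ρ₁ ≤ R₁) (hR₂ : ρ₂ ≤ R₂) (hn₀ : 0 ≤ n₀)
    (h12 : e₁₂ ≤ ρ₁ * ρ₂ * (Y / (q₁ * q₂) + 1)) (h1 : ρ₁ * (Y / q₁ - 1) - n₀ ≤ e₁)
    (h2 : ρ₂ * (Y / q₂ - 1) - n₀ ≤ e₂) (h2' : e₂ ≤ ρ₂ * (Y / q₂ + 1)) (he₂ : 0 ≤ e₂) :
    e₁₂ / Y - e₁ / Y * (e₂ / Y) ≤ (R₁ * R₂ + R₁ * (R₂ + n₀) + 2 * ((R₁ + n₀) * R₂)) / Y := by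
  have hY0 : 0 < Y := by linarith
  have hq₁0 : 0 < q₁ := by linarith
  have hq₂0 : 0 < q₂ := by linarith
  set u : ℝ := Y / q₁ with hu
  set v : ℝ := Y / q₂ with hv
  set w : ℝ := Y / (q₁ * q₂) with hw
  have hu1 : u ≤ Y := div_le_self hY0.le hq₁
  have hv1 : v ≤ Y := div_le_self hY0.le hq₂
  have hu0 : 0 ≤ u := div_nonneg hY0.le hq₁0.le
  have hv0 : 0 ≤ v := div_nonneg hY0.le hq₂0.le
  have huv : u * v = Y * w := by
    rw [hu, hv, hw, div_mul_div_comm, mul_div_assoc]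
  -- `e₁ e₂ ≥ (ρ₁(u − 1) − n₀) e₂ ≥ ρ₁ u (ρ₂ (v − 1) − n₀) − (ρ₁ + n₀) e₂`
  have hA : (ρ₁ * (u - 1) - n₀) * e₂ ≤ e₁ * e₂ := mul_le_mul_of_nonneg_right h1 he₂
  have hB : ρ₁ * u * (ρ₂ * (v - 1) - n₀) ≤ ρ₁ * u * e₂ :=
    mul_le_mul_of_nonneg_left h2 (mul_nonneg hρ₁ hu0)
  have hC : (ρ₁ + n₀) * e₂ ≤ (ρ₁ + n₀) * (ρ₂ * (v + 1)) :=
    mul_le_mul_of_nonneg_left h2' (by linarith)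
  have hkey : Y * e₁₂ - e₁ * e₂ ≤
      Y * (ρ₁ * ρ₂) + ρ₁ * u * (ρ₂ + n₀) + (ρ₁ + n₀) * (ρ₂ * (v + 1)) := by
    have h12' : Y * e₁₂ ≤ Y * (ρ₁ * ρ₂ * (w + 1)) := mul_le_mul_of_nonneg_left h12 hY0.le
    have e : Y * (ρ₁ * ρ₂ * (w + 1)) = ρ₁ * ρ₂ * (u * v) + Y * (ρ₁ * ρ₂) := by rw [huv]; ring
    nlinarith [hA, hB, hC, h12', e]
  have hb1 : ρ₁ * u * (ρ₂ + n₀) ≤ Y * (R₁ * (R₂ + n₀)) := by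
    calc ρ₁ * u * (ρ₂ + n₀) ≤ R₁ * Y * (R₂ + n₀) := by
          apply mul_le_mul (mul_le_mul hR₁ hu1 hu0 (hρ₁.trans hR₁)) (by linarith) (by linarith)
          exact mul_nonneg (hρ₁.trans hR₁) hY0.le
      _ = Y * (R₁ * (R₂ + n₀)) := by ring
  have hb2 : (ρ₁ + n₀) * (ρ₂ * (v + 1)) ≤ Y * (2 * ((R₁ + n₀) * R₂)) := by
    have h3 : ρ₂ * (v + 1) ≤ R₂ * (2 * Y) :=
      mul_le_mul hR₂ (by linarith) (by linarith) (hρ₂.trans hR₂)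
    calc (ρ₁ + n₀) * (ρ₂ * (v + 1)) ≤ (R₁ + n₀) * (R₂ * (2 * Y)) :=
          mul_le_mul (by linarith) h3 (mul_nonneg hρ₂ (by linarith)) (by linarith [hρ₁.trans hR₁])
      _ = Y * (2 * ((R₁ + n₀) * R₂)) := by ring
  have hb0 : Y * (ρ₁ * ρ₂) ≤ Y * (R₁ * R₂) :=
    mul_le_mul_of_nonneg_left (mul_le_mul hR₁ hR₂ hρ₂ (hρ₁.trans hR₁)) hY0.le
  have hfin : Y * e₁₂ - e₁ * e₂ ≤ Y * (R₁ * R₂ + R₁ * (R₂ + n₀) + 2 * ((R₁ + n₀) * R₂)) := by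
    linarith
  have e4 : e₁₂ / Y - e₁ / Y * (e₂ / Y) = (Y * e₁₂ - e₁ * e₂) / (Y * Y) := by
    field_simp
  rw [e4, div_le_div_iff₀ (mul_pos hY0 hY0) hY0]
  nlinarith [hfin, hY0]

/-- From natural-number counts to the real inequality of the upper side: if
`e₁₂ ≤ ρ₁ρ₂(⌊Y/(q₁q₂)⌋ + 1)`, `ρ₁⌊Y/q₁⌋ ≤ e₁ + n₀`, `ρ₂⌊Y/q₂⌋ ≤ e₂ + n₀`, `e₂ ≤ ρ₂(⌊Y/q₂⌋ + 1)`,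
`ρᵢ ≤ Rᵢ`, `qᵢ ≥ 1` (`Y = x + 1`), then
`e₁₂/Y − (e₁/Y)(e₂/Y) ≤ (R₁R₂ + R₁(R₂ + n₀) + 2(R₁ + n₀)R₂)/Y`. [folklore] -/
theorem nearPairCovUpper_counts {e₁ e₂ e₁₂ ρ₁ ρ₂ R₁ R₂ n₀ x q₁ q₂ : ℕ} (hq₁ : 0 < q₁) (hq₂ : 0 < q₂)
    (hρ₁ : ρ₁ ≤ R₁) (hρ₂ : ρ₂ ≤ R₂)
    (h12 : e₁₂ ≤ ρ₁ * ρ₂ * ((x + 1) / (q₁ * q₂) + 1))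
    (h1 : ρ₁ * ((x + 1) / q₁) ≤ e₁ + n₀) (h2 : ρ₂ * ((x + 1) / q₂) ≤ e₂ + n₀)
    (h2' : e₂ ≤ ρ₂ * ((x + 1) / q₂ + 1)) :
    (e₁₂ : ℝ) / ((x : ℝ) + 1) - (e₁ : ℝ) / ((x : ℝ) + 1) * ((e₂ : ℝ) / ((x : ℝ) + 1)) ≤
      ((R₁ : ℝ) * R₂ + R₁ * (R₂ + n₀) + 2 * ((R₁ + n₀) * R₂)) / ((x : ℝ) + 1) := by
  have hYnat : ((x + 1 : ℕ) : ℝ) = (x : ℝ) + 1 := by push_cast; ring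
  have hY1 : (1 : ℝ) ≤ (x : ℝ) + 1 := by
    have := (Nat.cast_nonneg x : (0 : ℝ) ≤ x)
    linarith
  have hq₁R : (1 : ℝ) ≤ q₁ := by exact_mod_cast hq₁
  have hq₂R : (1 : ℝ) ≤ q₂ := by exact_mod_cast hq₂
  have h12R : (e₁₂ : ℝ) ≤ (ρ₁ : ℝ) * ρ₂ * (((x : ℝ) + 1) / (q₁ * q₂) + 1) := by
    have hd : (((x + 1) / (q₁ * q₂) : ℕ) : ℝ) ≤ ((x : ℝ) + 1) / (q₁ * q₂) := by
      rw [← hYnat]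
      have := Nat.cast_div_le (m := x + 1) (n := q₁ * q₂) (α := ℝ)
      push_cast at this ⊢
      exact this
    have hP0 : (0 : ℝ) ≤ (ρ₁ : ℝ) * ρ₂ := by positivity
    calc (e₁₂ : ℝ) ≤ (ρ₁ : ℝ) * ρ₂ * ((((x + 1) / (q₁ * q₂) : ℕ) : ℝ) + 1) := by exact_mod_cast h12
      _ ≤ (ρ₁ : ℝ) * ρ₂ * (((x : ℝ) + 1) / (q₁ * q₂) + 1) := by gcongr
  have h1R : (ρ₁ : ℝ) * (((x : ℝ) + 1) / q₁ - 1) - n₀ ≤ e₁ := by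
    have hd : ((x : ℝ) + 1) / q₁ - 1 ≤ (((x + 1) / q₁ : ℕ) : ℝ) := by
      have := div_sub_one_le_cast_div (x + 1) hq₁
      rw [hYnat] at this
      exact this
    have h3 : (ρ₁ : ℝ) * (((x : ℝ) + 1) / q₁ - 1) ≤ (ρ₁ : ℝ) * (((x + 1) / q₁ : ℕ) : ℝ) :=
      mul_le_mul_of_nonneg_left hd (Nat.cast_nonneg _)
    have h4 : (ρ₁ : ℝ) * (((x + 1) / q₁ : ℕ) : ℝ) ≤ e₁ + n₀ := by exact_mod_cast h1
    linarith
  have h2R : (ρ₂ : ℝ) * (((x : ℝ) + 1) / q₂ - 1) - n₀ ≤ e₂ := by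
    have hd : ((x : ℝ) + 1) / q₂ - 1 ≤ (((x + 1) / q₂ : ℕ) : ℝ) := by
      have := div_sub_one_le_cast_div (x + 1) hq₂
      rw [hYnat] at this
      exact this
    have h3 : (ρ₂ : ℝ) * (((x : ℝ) + 1) / q₂ - 1) ≤ (ρ₂ : ℝ) * (((x + 1) / q₂ : ℕ) : ℝ) :=
      mul_le_mul_of_nonneg_left hd (Nat.cast_nonneg _)
    have h4 : (ρ₂ : ℝ) * (((x + 1) / q₂ : ℕ) : ℝ) ≤ e₂ + n₀ := by exact_mod_cast h2
    linarith
  have h2'R : (e₂ : ℝ) ≤ (ρ₂ : ℝ) * (((x : ℝ) + 1) / q₂ + 1) := by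
    have hd : (((x + 1) / q₂ : ℕ) : ℝ) ≤ ((x : ℝ) + 1) / q₂ := by
      rw [← hYnat]; exact Nat.cast_div_le
    calc (e₂ : ℝ) ≤ (ρ₂ : ℝ) * ((((x + 1) / q₂ : ℕ) : ℝ) + 1) := by exact_mod_cast h2'
      _ ≤ (ρ₂ : ℝ) * (((x : ℝ) + 1) / q₂ + 1) := by gcongr
  exact nearPairCovUpper_algebra hY1 hq₁R hq₂R (Nat.cast_nonneg ρ₁) (Nat.cast_nonneg ρ₂)
    (by exact_mod_cast hρ₁) (by exact_mod_cast hρ₂) (Nat.cast_nonneg n₀) h12R h1R h2R h2'R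
    (Nat.cast_nonneg e₂)

/-- **Near-pair covariance bound, upper side.**  For two irreducible integer polynomials `g₁, g₂`
of positive degree with positive leading coefficients there is `C` such that for all `x` and all
COPRIME prime powers `q₁, q₂`, with `Y = x + 1`, `m_i(n) = g_i(n)⁺`:
`#{n < Y : both}/Y − (#{n < Y : q₁ ∣ m₁(n) ≠ 0}/Y)·(#{n < Y : q₂ ∣ m₂(n) ≠ 0}/Y) ≤ C/Y`
— the joint frequency exceeds the product of the marginal frequencies by at most `C/Y` (CRT upper
count for the joint event, lower counts `ρ_i⌊Y/q_i⌋ − n₀` for the marginals, Hooley's uniform bound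
`ρ_i(p^a) ≤ d_i M_i` for the constants).  Together with `stub_nearPairCov` (the lower side) the pair
covariance is two-sidedly `O(1/Y)`. [folklore] -/
theorem nearPairCov_upper :
    ∀ (g₁ g₂ : ℤ[X]), Irreducible g₁ → 0 < g₁.natDegree → 0 < g₁.leadingCoeff →
      Irreducible g₂ → 0 < g₂.natDegree → 0 < g₂.leadingCoeff →
      ∃ C : ℝ, ∀ (x q₁ q₂ : ℕ), IsPrimePow q₁ → IsPrimePow q₂ → Nat.Coprime q₁ q₂ →
        (#((Finset.range (x + 1)).filter fun n : ℕ =>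
              (q₁ ∣ (g₁.eval (n : ℤ)).toNat ∧ (g₁.eval (n : ℤ)).toNat ≠ 0) ∧
                (q₂ ∣ (g₂.eval (n : ℤ)).toNat ∧ (g₂.eval (n : ℤ)).toNat ≠ 0)) : ℝ) / ((x : ℝ) + 1) -
          (#((Finset.range (x + 1)).filter fun n : ℕ =>
              q₁ ∣ (g₁.eval (n : ℤ)).toNat ∧ (g₁.eval (n : ℤ)).toNat ≠ 0) : ℝ) / ((x : ℝ) + 1) *
            ((#((Finset.range (x + 1)).filter fun n : ℕ =>
              q₂ ∣ (g₂.eval (n : ℤ)).toNat ∧ (g₂.eval (n : ℤ)).toNat ≠ 0) : ℝ) / ((x : ℝ) + 1)) ≤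
          C / ((x : ℝ) + 1) := by
  intro g₁ g₂ hirr₁ hdeg₁ hlc₁ hirr₂ hdeg₂ hlc₂
  obtain ⟨M₁, -, hM₁, -⟩ := exists_rootCount_primePow_le hirr₁ hdeg₁
  obtain ⟨M₂, -, hM₂, -⟩ := exists_rootCount_primePow_le hirr₂ hdeg₂
  obtain ⟨n₁, hn₁⟩ := eventually_atTop.1 (eventually_eval_natCast_pos hdeg₁ hlc₁)
  obtain ⟨n₂, hn₂⟩ := eventually_atTop.1 (eventually_eval_natCast_pos hdeg₂ hlc₂)
  have hpos₁ : ∀ n : ℕ, n₁ + n₂ ≤ n → 0 < g₁.eval (n : ℤ) := fun n hn => hn₁ n (by omega)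
  have hpos₂ : ∀ n : ℕ, n₁ + n₂ ≤ n → 0 < g₂.eval (n : ℤ) := fun n hn => hn₂ n (by omega)
  set R₁ : ℕ := g₁.natDegree * M₁ with hR₁
  set R₂ : ℕ := g₂.natDegree * M₂ with hR₂
  refine ⟨(R₁ : ℝ) * R₂ + R₁ * (R₂ + ((n₁ + n₂ : ℕ) : ℝ)) + 2 * ((R₁ + ((n₁ + n₂ : ℕ) : ℝ)) * R₂),
    fun x q₁ q₂ hq₁pp hq₂pp hcop => ?_⟩
  have hq₁ : 0 < q₁ := hq₁pp.pos
  have hq₂ : 0 < q₂ := hq₂pp.pos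
  have hρ₁ : polyRootCountMod ![g₁] q₁ ≤ R₁ := by
    obtain ⟨p, k, hp, -, hpk⟩ := (isPrimePow_nat_iff q₁).1 hq₁pp
    rw [← hpk]
    exact hM₁ p hp k
  have hρ₂ : polyRootCountMod ![g₂] q₂ ≤ R₂ := by
    obtain ⟨p, k, hp, -, hpk⟩ := (isPrimePow_nat_iff q₂).1 hq₂pp
    rw [← hpk]
    exact hM₂ p hp k
  -- joint upper count, marginal lower counts (+ n₀), marginal upper count
  have h12 := (card_filter_dvd_toNat_and_le_int g₁ g₂ q₁ q₂ (x + 1)).trans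
    (stub_crtPairCount g₁ g₂ q₁ q₂ (x + 1) hq₁ hq₂ hcop).2
  have h1 := (le_card_filter_range_dvd_eval g₁ hq₁ (x + 1)).trans
    (card_filter_dvd_eval_le_add g₁ q₁ (x + 1) hpos₁)
  have h2 := (le_card_filter_range_dvd_eval g₂ hq₂ (x + 1)).trans
    (card_filter_dvd_eval_le_add g₂ q₂ (x + 1) hpos₂)
  have h2' := (card_filter_dvd_toNat_le g₂ q₂ (x + 1)).trans
    (card_filter_range_dvd_eval_le g₂ hq₂ (x + 1))
  exact nearPairCovUpper_counts hq₁ hq₂ hρ₁ hρ₂ h12 h1 h2 h2'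

end Summit.Parity.BatemanHorn.Cruxes.SystemMomentDeficit.Localisation
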